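import Mathlib
import Summits.CriticalPhenomena.Ising3DConformalLimit.Theses.MarkovRigidity
import Summits.CriticalPhenomena.Ising3DConformalLimit.Theorems.MoebiusLimitExists.Negative.FreeReflections
import Literature.MathematicalPhysics.QuantumLattice.RandomFieldExtProofs
import Literature.MathematicalPhysics.QuantumLattice.EuclideanAction
import HarnessLib

/-!
# Route MarkovRigidity, support item `FieldRealisation` (stmt-CriticalPhenomena-11245):
# translation invariance, scale covariance and time-reflection invariance of the continuum law

Helper towards clause (b) of `FieldRealisation`.  A probability law `μ` on the field configurations
over `ℝ³` whose generating functional is the moment series of a correlation family `S`,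
`S_μ(f) = Σₙ iⁿ mₙ(f)/n!` with `mₙ(f) = ∫ (∏ᵢ f(xᵢ)) Sₙ(x) dx`, is invariant under the transpose
`FieldConfig.act T` of every continuous linear map `T` of test functions preserving all the `mₙ`
(`map_act_eq_self`: the image law has generating functional `S_μ ∘ T`, and laws on `𝒮'(ℝ³)` are
determined by their generating functionals, tree `ext_of_genFunctional_holds`).  The `mₙ` are
preserved by translations when `S` is translation invariant (Haar invariance of Lebesgue measure),
by the renormalised dilations `f ↦ s^{Δ−3} f(·/s)` when `S` is scale covariant with dimension `Δ`
(`Measure.integral_comp_smul`), and by the time reflection `θ` when `S` is a pointwise scaling limit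
of the critical `ℤ³` correlators normalised off the coincident configurations (`limit_signFlip`:
any such limit is invariant under coordinate sign flips).

References: Glimm–Jaffe 1987 §6.1 (OS1–OS3); Gel'fand–Vilenkin IV §4.1.  No definitions.
-/

noncomputable section

namespace Summit.CriticalPhenomena.Ising3DConformalLimit.MarkovRigidityFieldRealisation

open MeasureTheory Filter Complex Literature.Probability.LatticeModels
  Literature.MathematicalPhysics.QuantumLattice
open Summit.CriticalPhenomena.Ising3DConformalLimit
open scoped Topology Nat ENNReal

variable {S : CorrFamily 3}
variable {μ : Measure (FieldConfig (EuclideanSpace ℝ (Fin 3)))}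

/-! ### Invariance under moment-preserving transformations of test functions -/

/-- The generating functional of an image law under the transpose of `T` is `S_μ ∘ T`.
[cite: GlimmJaffe1987, §6.1] -/
theorem genFunctional_map_act (T : SchwartzMap (EuclideanSpace ℝ (Fin 3)) ℝ →L[ℝ]
      SchwartzMap (EuclideanSpace ℝ (Fin 3)) ℝ) (f : SchwartzMap (EuclideanSpace ℝ (Fin 3)) ℝ) :
    genFunctional (μ.map (FieldConfig.act T)) f = genFunctional μ (T f) := by
  unfold genFunctional
  rw [integral_map (FieldConfig.measurable_act T).aemeasurable]
  · rfl
  · exact (Complex.continuous_exp.comp (continuous_const.mul (Complex.continuous_ofReal.comp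
      (continuous_eval_const f)))).aestronglyMeasurable

/-- **Invariance of the law under moment-preserving transformations.**  If `S_μ` is the moment
series of `S` and `T` preserves every smeared moment `mₙ(f) = ∫ (∏ᵢ f(xᵢ)) Sₙ(x) dx`, then
`(act T)_* μ = μ`. [cite: GelfandVilenkinIV1964, Ch. IV §4.1] -/
theorem map_act_eq_self [IsProbabilityMeasure μ]
    (hμC : ∀ f : SchwartzMap (EuclideanSpace ℝ (Fin 3)) ℝ, genFunctional μ f =
      ∑' n : ℕ, I ^ n * ((∫ x : Fin n → EuclideanSpace ℝ (Fin 3),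
        (∏ i, f (x i)) * S n x : ℝ) : ℂ) / n !)
    (T : SchwartzMap (EuclideanSpace ℝ (Fin 3)) ℝ →L[ℝ] SchwartzMap (EuclideanSpace ℝ (Fin 3)) ℝ)
    (hT : ∀ (n : ℕ) (f : SchwartzMap (EuclideanSpace ℝ (Fin 3)) ℝ),
      ∫ x : Fin n → EuclideanSpace ℝ (Fin 3), (∏ i, (T f) (x i)) * S n x =
        ∫ x : Fin n → EuclideanSpace ℝ (Fin 3), (∏ i, f (x i)) * S n x) :
    μ.map (FieldConfig.act T) = μ := by
  haveI : IsProbabilityMeasure (μ.map (FieldConfig.act T)) :=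
    Measure.isProbabilityMeasure_map (FieldConfig.measurable_act T).aemeasurable
  refine ext_of_genFunctional_holds (E := EuclideanSpace ℝ (Fin 3)) (funext fun f => ?_)
  rw [genFunctional_map_act, hμC, hμC]
  simp_rw [hT]

/-! ### Translations -/

/-- Translations preserve the smeared moments of a translation-invariant family.
[cite: GlimmJaffe1987, §6.1] -/
theorem moments_translate (htr : IsTranslationInvariant S) (a : EuclideanSpace ℝ (Fin 3)) (n : ℕ)
    (f : SchwartzMap (EuclideanSpace ℝ (Fin 3)) ℝ) :
    ∫ x : Fin n → EuclideanSpace ℝ (Fin 3), (∏ i, (translateTest a f) (x i)) * S n x =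
      ∫ x : Fin n → EuclideanSpace ℝ (Fin 3), (∏ i, f (x i)) * S n x := by
  simp only [translateTest_apply]
  have h := integral_add_right_eq_self (μ := (volume : Measure (Fin n → EuclideanSpace ℝ (Fin 3))))
    (fun x : Fin n → EuclideanSpace ℝ (Fin 3) => (∏ i, f (x i)) * S n x) (fun _ => -a)
  rw [← h]
  congr 1
  funext x
  have hS : S n (x + fun _ => -a) = S n x := htr n (-a) x
  rw [hS]
  simp only [Pi.add_apply, ← sub_eq_add_neg]

/-- **Translation invariance of the law.** [cite: GlimmJaffe1987, §6.1] -/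
theorem isTranslationInvariantLaw_of [IsProbabilityMeasure μ]
    (hμC : ∀ f : SchwartzMap (EuclideanSpace ℝ (Fin 3)) ℝ, genFunctional μ f =
      ∑' n : ℕ, I ^ n * ((∫ x : Fin n → EuclideanSpace ℝ (Fin 3),
        (∏ i, f (x i)) * S n x : ℝ) : ℂ) / n !)
    (htr : IsTranslationInvariant S) : IsTranslationInvariantLaw μ := by
  intro a
  exact map_act_eq_self hμC (translateTest (-a)) fun n f => moments_translate htr (-a) n f

/-! ### Dilations -/

/-- The renormalised dilations `f ↦ s^{Δ−3} f(·/s)` preserve the smeared moments of a family which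
is scale covariant with dimension `Δ`. [cite: FrancescoMathieuSenechal1997, §4.3.1] -/
theorem moments_dilate {Δ : ℝ} (hsc : IsScaleCovariant Δ S) (s : ℝ) (hs : 0 < s) (n : ℕ)
    (f : SchwartzMap (EuclideanSpace ℝ (Fin 3)) ℝ) :
    ∫ x : Fin n → EuclideanSpace ℝ (Fin 3),
        (∏ i, (((s ^ (Δ - 3 : ℝ)) • dilateTest s hs.ne') f) (x i)) * S n x =
      ∫ x : Fin n → EuclideanSpace ℝ (Fin 3), (∏ i, f (x i)) * S n x := by
  simp only [_root_.smul_apply, dilateTest_apply, smul_eq_mul]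
  -- `x = s • y`
  set G : (Fin n → EuclideanSpace ℝ (Fin 3)) → ℝ := fun y => (∏ i, f (y i)) * S n y with hG
  have hcomp : (fun x : Fin n → EuclideanSpace ℝ (Fin 3) =>
      (∏ i, s ^ (Δ - 3 : ℝ) * f (s⁻¹ • x i)) * S n x) =
      fun x => (s ^ (Δ - 3 : ℝ)) ^ n * s ^ (-(n : ℝ) * Δ) * G (s⁻¹ • x) := by
    funext x
    rw [Finset.prod_mul_distrib, Finset.prod_const, Finset.card_univ, Fintype.card_fin, hG]
    dsimp only
    have hx : S n x = S n (fun i => s • (s⁻¹ • x) i) := by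
      congr 1; funext i; rw [Pi.smul_apply, smul_smul, mul_inv_cancel₀ hs.ne', one_smul]
    rw [hx, hsc n s hs (s⁻¹ • x)]
    simp only [Pi.smul_apply]
    ring
  rw [hcomp, integral_const_mul, Measure.integral_comp_inv_smul]
  have hdim : Module.finrank ℝ (Fin n → EuclideanSpace ℝ (Fin 3)) = n * 3 := by
    rw [Module.finrank_pi_fintype]
    simp
  rw [hdim, abs_of_pos (pow_pos hs _), smul_eq_mul, ← mul_assoc]
  -- the exponents cancel
  have hexp : (s ^ (Δ - 3 : ℝ)) ^ n * s ^ (-(n : ℝ) * Δ) * s ^ (n * 3) = 1 := by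
    rw [← Real.rpow_mul_natCast hs.le, ← Real.rpow_natCast s (n * 3), ← Real.rpow_add hs,
      ← Real.rpow_add hs]
    have : (Δ - 3) * (n : ℝ) + -(n : ℝ) * Δ + ((n * 3 : ℕ) : ℝ) = 0 := by push_cast; ring
    rw [this, Real.rpow_zero]
  rw [hexp, one_mul]

/-- **Scale covariance of the law.** [cite: FrancescoMathieuSenechal1997, §4.3.1] -/
theorem map_act_scale_eq_self [IsProbabilityMeasure μ] {Δ : ℝ}
    (hμC : ∀ f : SchwartzMap (EuclideanSpace ℝ (Fin 3)) ℝ, genFunctional μ f =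
      ∑' n : ℕ, I ^ n * ((∫ x : Fin n → EuclideanSpace ℝ (Fin 3),
        (∏ i, f (x i)) * S n x : ℝ) : ℂ) / n !)
    (hsc : IsScaleCovariant Δ S) (s : ℝ) (hs : 0 < s) :
    μ.map (FieldConfig.act ((s ^ (Δ - 3 : ℝ)) • dilateTest s hs.ne')) = μ :=
  map_act_eq_self hμC _ fun n f => moments_dilate hsc s hs n f

/-! ### Time reflection -/

/-- A pointwise scaling limit of the critical `ℤ³` correlators, normalised off the coincident
configurations, is invariant under the time reflection `θ` applied to every point.
[cite: FriedliVelenik2017, Exercise 3.14, p. 115] -/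
theorem limit_theta {ρ : ℝ → ℝ} (hlim : HasPointwiseScalingLimit (criticalCorr 3) ρ S)
    (hzero : ∀ n z, z ∉ NonCoincident 3 n → S n z = 0) {n : ℕ}
    (x : Fin n → EuclideanSpace ℝ (Fin 3)) :
    S n (fun i => timeReflection 3 (x i)) = S n x := by
  by_cases hx : x ∈ NonCoincident 3 n
  · refine MoebiusLimitExistsNegative.limit_signFlip hlim (fun j => if j = 0 then -1 else 1)
      (timeReflection 3) (fun p j => ?_) hx
    rw [timeReflection_apply]
    split_ifs <;> simp
  · have hx' : (fun i => timeReflection 3 (x i)) ∉ NonCoincident 3 n :=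
      fun h => hx ((MoebiusLimitExistsNegative.map_mem_nonCoincident_iff (timeReflection 3) x).1 h)
    rw [hzero n _ hx', hzero n x hx]

/-- The time reflection preserves the smeared moments. [cite: OS1973, §2] -/
theorem moments_theta {ρ : ℝ → ℝ} (hlim : HasPointwiseScalingLimit (criticalCorr 3) ρ S)
    (hzero : ∀ n z, z ∉ NonCoincident 3 n → S n z = 0) (n : ℕ)
    (f : SchwartzMap (EuclideanSpace ℝ (Fin 3)) ℝ) :
    ∫ x : Fin n → EuclideanSpace ℝ (Fin 3), (∏ i, (thetaTest 3 f) (x i)) * S n x =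
      ∫ x : Fin n → EuclideanSpace ℝ (Fin 3), (∏ i, f (x i)) * S n x := by
  simp only [thetaTest_apply]
  set e : (Fin n → EuclideanSpace ℝ (Fin 3)) ≃ᵐ (Fin n → EuclideanSpace ℝ (Fin 3)) :=
    MeasurableEquiv.piCongrRight fun _ => (timeReflection 3).toHomeomorph.toMeasurableEquiv with hedef
  have he : ∀ x, e x = fun i => timeReflection 3 (x i) := fun x => rfl
  have hmp : MeasurePreserving e :=
    volume_preserving_pi fun _ : Fin n => (timeReflection 3).measurePreserving
  have h := hmp.integral_comp' (fun y : Fin n → EuclideanSpace ℝ (Fin 3) => (∏ i, f (y i)) * S n y)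
  rw [← h]
  congr 1
  funext x
  rw [he, limit_theta hlim hzero x]

/-- **Time-reflection invariance of the law.** [cite: OS1973, §2] -/
theorem isTimeReflectionInvariantLaw_of [IsProbabilityMeasure μ] {ρ : ℝ → ℝ}
    (hμC : ∀ f : SchwartzMap (EuclideanSpace ℝ (Fin 3)) ℝ, genFunctional μ f =
      ∑' n : ℕ, I ^ n * ((∫ x : Fin n → EuclideanSpace ℝ (Fin 3),
        (∏ i, f (x i)) * S n x : ℝ) : ℂ) / n !)
    (hlim : HasPointwiseScalingLimit (criticalCorr 3) ρ S)
    (hzero : ∀ n z, z ∉ NonCoincident 3 n → S n z = 0) :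
    IsTimeReflectionInvariantLaw 3 μ :=
  map_act_eq_self hμC (thetaTest 3) fun n f => moments_theta hlim hzero n f

end Summit.CriticalPhenomena.Ising3DConformalLimit.MarkovRigidityFieldRealisation


end
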